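import Mathlib
import Literature.RingTheory.MvPolynomial.MultigradedBezoutCount

/-!
# Crux `DetQP.DetqpSuperquadratic` (stmt-ValiantsHypothesis-0318), line `sectional-class-ladder`
# (v2, ND route) — stubs `stub_minimalPrime_of_nondegenerate` and `stub_mixedBezoutNondegenerate`:
# non-degenerate multiprojective zeros are minimal primes, hence at most the mixed Bézout number

Let `S = K[X_0, …, X_{n-1}]` be multigraded by the blocks of `blk : Fin n → ι`, `z` a point with a
non-zero coordinate in every block, `𝔓_z = ker (X_i ↦ z_i T_{blk i})` its multi-cone prime
(Part II of `Literature/RingTheory/MvPolynomial/MultigradedBezoutCount`), and `Q_1, …, Q_r`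
multihomogeneous forms vanishing at `z` whose Jacobian at `z` has kernel inside the `|ι|` torus
directions `(c_{blk i} z_i)_i` (a NON-DEGENERATE zero).  Then `𝔓_z` is a minimal prime of
`𝔞 = (Q_j)_j` (`stub_minimalPrime_of_nondegenerate`), so finitely many such zeros with pairwise
distinct torus orbits number at most the mixed Bézout number `[T^{(n_l-1)_l}] Π_j (Σ_l δ_{j,l} T_l)`
(`stub_mixedBezoutNondegenerate`: the tree's `card_le_mixedBezout` and
`hilbert_inf_multiCone_eq_card`, transported to finite index types as in
`card_le_mixedBezout_of_isolated_fintype`).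

Minimality, elementary proof.  Pick pivots `p_l` (`z_{p_l} ≠ 0`) and put
`ℓ_i = X_i - (z_i / z_{p_{blk i}}) X_{p_{blk i}}`, `𝔟 = (ℓ_i)_i`.  (1) `𝔓_z = 𝔟`: the ring map
`ψ : X_i ↦ (z_i / z_{p_{blk i}}) X_{p_{blk i}}` factors through `φ_z` and `g - ψ g ∈ 𝔟` (induction
on `g`), so `φ_z g = 0 ⟹ ψ g = 0 ⟹ g ∈ 𝔟`.  (2) The differentials `dℓ_i(z)` kill the torus
directions `⊇ ⋂_j ker dQ_j(z)`, so `dℓ_{i₀}(z) = Σ_j M_j dQ_j(z)` (`mem_span_of_iInf_ker_le_ker`).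
(3) `g = Σ_j M_j Q_j - ℓ_{i₀} ∈ 𝔟` has `dg(z) = 0`; writing `g = Σ_i G_i ℓ_i` and differentiating
at `z` along a non-pivot `e_{i'}` gives `G_{i'}(z) = 0`, so `g ∈ 𝔪_z 𝔟` (`𝔪_z = ker eval_z`) and
`𝔟 ≤ 𝔞 + 𝔪_z 𝔟`.  (4) For a prime `𝔞 ≤ 𝔮 ≤ 𝔓_z ≤ 𝔪_z`, Nakayama
(`Submodule.exists_sub_one_mem_and_smul_eq_zero_of_fg_of_le_smul`) on the image of `𝔟` in `S/𝔮`
gives `s ∉ 𝔮` with `s 𝔟 ⊆ 𝔮`, whence `𝔟 ⊆ 𝔮` and `𝔮 = 𝔓_z`.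
Reference: W. Fulton, *Intersection Theory*, 2nd ed., Springer 1998, Example 12.3.1 [Fulton1998].
-/

-- `Summit.ValiantsHypothesis.ValiantsHypothesis.…` is the tree's mandated single-conjunct layout
-- (Sub = Summit), so the duplicated namespace component is intended.
set_option linter.dupNamespace false

namespace Summit.ValiantsHypothesis.ValiantsHypothesis.Theorems.DetQPDetqpSuperquadratic

open MvPolynomial Finset
open Literature.RingTheory.MvPolynomial

/-- **A non-degenerate zero of a multihomogeneous system is a minimal prime.** Let
`Q_1, …, Q_r ∈ K[X_0, …, X_{n-1}]` be multihomogeneous for the blocks of `blk : Fin n → ι`,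
vanishing at a point `z` with a non-zero coordinate in every block, and suppose the kernel of the
Jacobian `(∂_i Q_j(z))` consists of torus directions `(c_{blk i} z_i)_i` only. Then the multi-cone
prime `𝔓_z = ker (X_i ↦ z_i T_{blk i})` is a minimal prime of `(Q_1, …, Q_r)`.
[cite: Fulton1998, Example 12.3.1] -/
theorem stub_minimalPrime_of_nondegenerate {K : Type} [Field K] {ι : Type} [Fintype ι] [DecidableEq ι]
    {n : ℕ} (blk : Fin n → ι) {z : Fin n → K} (hz : ∀ l, ∃ i, blk i = l ∧ z i ≠ 0)
    {r : ℕ} (Q : Fin r → MvPolynomial (Fin n) K) (δ : Fin r → ι → ℕ)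
    (hQ : ∀ j, (Q j).IsWeightedHomogeneous (fun i => (Pi.single (blk i) 1 : ι → ℕ)) (δ j))
    (hQz : ∀ j, MvPolynomial.eval z (Q j) = 0)
    (hnd : ∀ w : Fin n → K,
      (∀ j, ∑ i, MvPolynomial.eval z (MvPolynomial.pderiv i (Q j)) * w i = 0) →
        ∃ c : ι → K, w = fun i => c (blk i) * z i) :
    RingHom.ker (MvPolynomial.eval₂Hom (C : K →+* MvPolynomial ι K) (fun i => C (z i) * X (blk i)))
      ∈ (Ideal.span (Set.range Q)).minimalPrimes := by
  classical
  -- pivots `p l` in every block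
  choose p hp hzp using hz
  set φ := MvPolynomial.eval₂Hom (C : K →+* MvPolynomial ι K) (fun i => C (z i) * X (blk i))
    with hφ
  set 𝔓 : Ideal (MvPolynomial (Fin n) K) := RingHom.ker φ with h𝔓
  haveI h𝔓prime : 𝔓.IsPrime := ker_multiConeSubst_isPrime blk z
  set 𝔞 : Ideal (MvPolynomial (Fin n) K) := Ideal.span (Set.range Q) with h𝔞
  set 𝔪 : Ideal (MvPolynomial (Fin n) K) := RingHom.ker (MvPolynomial.eval z) with h𝔪
  -- the linear forms `ℓ_i = X_i - (z_i / z_{p (blk i)}) X_{p (blk i)}` and their span `𝔟`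
  set a : Fin n → K := fun i => z i * (z (p (blk i)))⁻¹ with ha
  set ℓ : Fin n → MvPolynomial (Fin n) K := fun i => X i - C (a i) * X (p (blk i)) with hℓ
  set 𝔟 : Ideal (MvPolynomial (Fin n) K) := Ideal.span (Set.range ℓ) with h𝔟
  have hℓmem : ∀ i, ℓ i ∈ 𝔟 := fun i => Ideal.subset_span ⟨i, rfl⟩
  have hℓz : ∀ i, MvPolynomial.eval z (ℓ i) = 0 := by
    intro i
    simp only [hℓ, ha, map_sub, map_mul, MvPolynomial.eval_C, MvPolynomial.eval_X]
    rw [mul_assoc, inv_mul_cancel₀ (hzp (blk i)), mul_one, sub_self]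
  have hℓpiv : ∀ i, p (blk i) = i → ℓ i = 0 := by
    intro i hi
    have hzi : z i ≠ 0 := by rw [← hi]; exact hzp (blk i)
    simp only [hℓ, ha]
    rw [hi, mul_inv_cancel₀ hzi, C_1, one_mul, sub_self]
  -- `𝔞 ≤ 𝔓 ≤ 𝔪`
  have h𝔞𝔓 : 𝔞 ≤ 𝔓 := by
    rw [h𝔞, Ideal.span_le]
    rintro _ ⟨j, rfl⟩
    exact (mem_ker_multiConeSubst_iff_of_isWeightedHomogeneous blk z (hQ j)).mpr (hQz j)
  have h𝔓𝔪 : 𝔓 ≤ 𝔪 := by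
    intro g hg
    rw [h𝔪, RingHom.mem_ker]
    simpa using eval_torusSmul_eq_zero_of_mem_ker blk hg 1
  have h𝔪1 : (1 : MvPolynomial (Fin n) K) ∉ 𝔪 := by
    rw [h𝔪, RingHom.mem_ker, map_one]; exact one_ne_zero
  -- (1) `𝔓 = 𝔟`
  set κ := MvPolynomial.eval₂Hom (C : K →+* MvPolynomial ι K) (fun l => C (z (p l))⁻¹ * X l)
    with hκ
  set θ := MvPolynomial.eval₂Hom (C : K →+* MvPolynomial (Fin n) K)
    (fun l => (X (p l) : MvPolynomial (Fin n) K)) with hθ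
  set ψ : MvPolynomial (Fin n) K →+* MvPolynomial (Fin n) K := θ.comp (κ.comp φ) with hψ
  have hψC : ∀ c : K, ψ (C c) = C c := fun c => by
    simp only [hψ, hθ, hκ, hφ, RingHom.comp_apply, MvPolynomial.eval₂Hom_C]
  have hψX : ∀ i, ψ (X i) = C (a i) * X (p (blk i)) := fun i => by
    simp only [hψ, hθ, hκ, hφ, ha, RingHom.comp_apply, MvPolynomial.eval₂Hom_X', map_mul,
      MvPolynomial.eval₂Hom_C]
    rw [mul_assoc]
  have hsubψ : ∀ g, g - ψ g ∈ 𝔟 := by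
    intro g
    induction g using MvPolynomial.induction_on with
    | C c => rw [hψC, sub_self]; exact 𝔟.zero_mem
    | add f g hf hg => rw [map_add, add_sub_add_comm]; exact 𝔟.add_mem hf hg
    | mul_X f i hf =>
      have h : f * X i - ψ (f * X i) = (f - ψ f) * X i + ψ f * (X i - ψ (X i)) := by
        rw [map_mul]; ring
      rw [h]
      refine 𝔟.add_mem (𝔟.mul_mem_right _ hf) (𝔟.mul_mem_left _ ?_)
      rw [hψX]
      exact hℓmem i
  have h𝔓𝔟 : 𝔓 ≤ 𝔟 := fun g hg => by
    have h0 : φ g = 0 := by rwa [h𝔓, RingHom.mem_ker] at hg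
    simpa [hψ, h0] using hsubψ g
  have h𝔟𝔓 : 𝔟 ≤ 𝔓 := by
    rw [h𝔟, Ideal.span_le]
    rintro _ ⟨i, rfl⟩
    have hai : (C (a i) * C (z (p (blk i))) : MvPolynomial ι K) = C (z i) := by
      rw [← map_mul, ha]; exact congrArg C (inv_mul_cancel_right₀ (hzp (blk i)) (z i))
    rw [SetLike.mem_coe, h𝔓, RingHom.mem_ker]
    show φ (X i - C (a i) * X (p (blk i))) = 0
    rw [map_sub, map_mul, hφ, MvPolynomial.eval₂Hom_C, MvPolynomial.eval₂Hom_X',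
      MvPolynomial.eval₂Hom_X', hp, ← mul_assoc, hai, sub_self]
  have h𝔞𝔟 : 𝔞 ≤ 𝔟 := h𝔞𝔓.trans h𝔓𝔟
  -- (2) differentials: `∂_{i'} ℓ_i (z)`
  have hdℓ : ∀ i i', MvPolynomial.eval z (pderiv i' (ℓ i)) =
      (if i = i' then 1 else 0) - (if p (blk i) = i' then a i else 0) := by
    intro i i'
    simp only [hℓ, map_sub, pderiv_C_mul, pderiv_X, Pi.single_apply, map_mul,
      MvPolynomial.eval_C]
    split_ifs <;> simp
  -- the Jacobian rows and the differentials of the `ℓ_i` as functionals on `K^n`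
  set L : Fin r → (Fin n → K) →ₗ[K] K := fun j =>
    ∑ i, (MvPolynomial.eval z (pderiv i (Q j))) • (LinearMap.proj i : (Fin n → K) →ₗ[K] K)
    with hL
  set Kf : Fin n → (Fin n → K) →ₗ[K] K := fun i₀ =>
    (LinearMap.proj i₀ : (Fin n → K) →ₗ[K] K) - (a i₀) • (LinearMap.proj (p (blk i₀)))
    with hKf
  have hL_apply : ∀ j w, L j w = ∑ i, MvPolynomial.eval z (pderiv i (Q j)) * w i := fun j w => by
    simp only [hL, LinearMap.coe_sum, Finset.sum_apply, LinearMap.smul_apply,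
      LinearMap.coe_proj, Function.eval, smul_eq_mul]
  have hKf_apply : ∀ i₀ w, Kf i₀ w = w i₀ - a i₀ * w (p (blk i₀)) := fun i₀ w => by
    simp only [hKf, LinearMap.sub_apply, LinearMap.smul_apply, LinearMap.coe_proj,
      Function.eval, smul_eq_mul]
  have hspan : ∀ i₀, Kf i₀ ∈ Submodule.span K (Set.range L) := by
    intro i₀
    apply mem_span_of_iInf_ker_le_ker
    intro w hw
    rw [Submodule.mem_iInf] at hw
    obtain ⟨c, rfl⟩ := hnd w fun j => by
      have h := hw j
      rwa [LinearMap.mem_ker, hL_apply] at h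
    rw [LinearMap.mem_ker, hKf_apply, hp]
    simp only [ha]
    rw [mul_comm (c (blk i₀)) (z (p (blk i₀))), ← mul_assoc, inv_mul_cancel_right₀ (hzp _),
      mul_comm, sub_self]
  have hM : ∀ i₀, ∃ M : Fin r → K, ∀ i',
      ∑ j, M j * MvPolynomial.eval z (pderiv i' (Q j)) =
        (if i₀ = i' then 1 else 0) - (if p (blk i₀) = i' then a i₀ else 0) := by
    intro i₀
    obtain ⟨M, hMeq⟩ := (Submodule.mem_span_range_iff_exists_fun K).mp (hspan i₀)
    refine ⟨M, fun i' => ?_⟩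
    have h := LinearMap.congr_fun hMeq (Pi.single i' 1)
    rw [LinearMap.coe_sum, Finset.sum_apply, hKf_apply] at h
    simp only [LinearMap.smul_apply, hL_apply, smul_eq_mul, Pi.single_apply, mul_ite, mul_one,
      mul_zero, Finset.sum_ite_eq', Finset.mem_univ, if_true] at h
    exact h
  -- (3) an element of `𝔟` with vanishing differential at `z` lies in `𝔪 𝔟`
  have hclaim : ∀ g ∈ 𝔟, (∀ i', MvPolynomial.eval z (pderiv i' g) = 0) → g ∈ 𝔪 * 𝔟 := by
    intro g hg hdg
    obtain ⟨G, rfl⟩ := (Ideal.mem_span_range_iff_exists_fun).mp hg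
    have hGz : ∀ i', p (blk i') ≠ i' → MvPolynomial.eval z (G i') = 0 := by
      intro i' hi'
      have hpiv : ∀ i, (if p (blk i) = i' then a i else 0) = 0 := fun i =>
        if_neg fun h' => hi' (by rw [← h', hp])
      have h := hdg i'
      rw [map_sum, map_sum] at h
      simp only [pderiv_mul, map_add, map_mul, hℓz, mul_zero, zero_add, hdℓ, hpiv, sub_zero,
        mul_ite, mul_one, Finset.sum_ite_eq', Finset.mem_univ, if_true] at h
      exact h
    refine Ideal.sum_mem _ fun i _ => ?_
    by_cases hi : p (blk i) = i
    · rw [hℓpiv i hi, mul_zero]; exact Ideal.zero_mem _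
    · exact Ideal.mul_mem_mul (by rw [h𝔪, RingHom.mem_ker]; exact hGz i hi) (hℓmem i)
  -- hence `𝔟 ≤ 𝔞 + 𝔪 𝔟`
  have hkey : 𝔟 ≤ 𝔞 ⊔ 𝔪 * 𝔟 := by
    rw [h𝔟, Ideal.span_le]
    rintro _ ⟨i₀, rfl⟩
    obtain ⟨M, hMi⟩ := hM i₀
    set g : MvPolynomial (Fin n) K := (∑ j, C (M j) * Q j) - ℓ i₀ with hg
    have hQ𝔟 : (∑ j, C (M j) * Q j) ∈ 𝔞 :=
      Ideal.sum_mem _ fun j _ => Ideal.mul_mem_left _ _ (Ideal.subset_span ⟨j, rfl⟩)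
    have hg𝔟 : g ∈ Ideal.span (Set.range ℓ) := Ideal.sub_mem _ (h𝔞𝔟 hQ𝔟) (hℓmem i₀)
    have hdg : ∀ i', MvPolynomial.eval z (pderiv i' g) = 0 := by
      intro i'
      rw [hg, map_sub, map_sub, map_sum, map_sum, hdℓ]
      simp only [pderiv_C_mul, map_mul, MvPolynomial.eval_C]
      rw [hMi i', sub_self]
    rw [SetLike.mem_coe, show ℓ i₀ = (∑ j, C (M j) * Q j) - g by rw [hg, sub_sub_cancel]]
    exact Ideal.sub_mem _ (Ideal.mem_sup_left hQ𝔟) (Ideal.mem_sup_right (hclaim g hg𝔟 hdg))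
  -- (4) minimality via Nakayama in `S ⧸ 𝔮`
  refine ⟨⟨h𝔓prime, h𝔞𝔓⟩, fun 𝔮 h𝔮 h𝔮𝔓 => ?_⟩
  obtain ⟨h𝔮prime, h𝔞𝔮⟩ := h𝔮
  suffices h𝔟𝔮 : 𝔟 ≤ 𝔮 from h𝔓𝔟.trans h𝔟𝔮
  have h𝔮𝔪 : 𝔮 ≤ 𝔪 := h𝔮𝔓.trans h𝔓𝔪
  set N : Submodule (MvPolynomial (Fin n) K) (MvPolynomial (Fin n) K ⧸ 𝔮) :=
    Submodule.map 𝔮.mkQ 𝔟 with hN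
  have hNfg : N.FG := (Submodule.fg_span (Set.finite_range ℓ)).map _
  have h𝔞bot : Submodule.map 𝔮.mkQ 𝔞 = ⊥ := by
    rw [← LinearMap.le_ker_iff_map, Submodule.ker_mkQ]; exact h𝔞𝔮
  have hNle : N ≤ 𝔪 • N := by
    calc N ≤ Submodule.map 𝔮.mkQ (𝔞 ⊔ 𝔪 * 𝔟) := Submodule.map_mono hkey
      _ = 𝔪 • N := by
        rw [Submodule.map_sup, h𝔞bot, bot_sup_eq, ← Ideal.smul_eq_mul, Submodule.map_smul'']
  obtain ⟨s, hs1, hsN⟩ :=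
    Submodule.exists_sub_one_mem_and_smul_eq_zero_of_fg_of_le_smul 𝔪 N hNfg hNle
  have hs𝔮 : s ∉ 𝔮 := fun h => h𝔪1 (by simpa using 𝔪.sub_mem (h𝔮𝔪 h) hs1)
  intro b hb
  have h1 : s • 𝔮.mkQ b = 0 := hsN _ (Submodule.mem_map_of_mem hb)
  rw [← map_smul, Submodule.mkQ_apply, Submodule.Quotient.mk_eq_zero, smul_eq_mul] at h1
  exact (h𝔮prime.mem_or_mem h1).resolve_left hs𝔮

namespace MixedBezoutNondegenerate

/-- **Refined Bézout count of non-degenerate zeros, `Fin`-indexed form**: for non-zero forms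
`Q_1, …, Q_r` (`r + |ι| = n`, all blocks non-empty) multihomogeneous for `blk : Fin n → ι` of
multidegrees `δ_j`, a finite set `T` of non-degenerate common zeros with a non-zero coordinate in
every block and pairwise distinct torus orbits has `|T| ≤ [T^{(n_l - 1)_l}] Π_j (Σ_l δ_{j,l} T_l)`
(`card_le_mixedBezout` on the minimal primes `𝔓_z`, `z ∈ T`). [cite: Fulton1998, Example 12.3.1] -/
theorem card_le_mixedBezout_of_nondegenerate {K : Type} [Field K] {ι : Type} [Fintype ι]
    [DecidableEq ι] [Nonempty ι] {n r : ℕ} (blk : Fin n → ι)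
    (hblk : ∀ l, 1 ≤ ((univ : Finset (Fin n)).filter (fun i => blk i = l)).card)
    (hr : r + Fintype.card ι = n)
    (Q : Fin r → MvPolynomial (Fin n) K) (δ : Fin r → ι → ℕ)
    (hQ : ∀ j, (Q j).IsWeightedHomogeneous (fun i => (Pi.single (blk i) 1 : ι → ℕ)) (δ j))
    (hQ0 : ∀ j, Q j ≠ 0) (T : Finset (Fin n → K))
    (hT : ∀ z ∈ T, ∀ l, ∃ i, blk i = l ∧ z i ≠ 0)
    (hTdist : ∀ z ∈ T, ∀ z' ∈ T, (∃ c : ι → K, z' = fun i => c (blk i) * z i) → z' = z)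
    (hTQ : ∀ z ∈ T, ∀ j, MvPolynomial.eval z (Q j) = 0)
    (hnd : ∀ z ∈ T, ∀ w : Fin n → K,
      (∀ j, ∑ i, MvPolynomial.eval z (MvPolynomial.pderiv i (Q j)) * w i = 0) →
        ∃ c : ι → K, w = fun i => c (blk i) * z i) :
    T.card ≤ coeff (Finsupp.equivFunOnFinite.symm fun l =>
        ((univ : Finset (Fin n)).filter (fun i => blk i = l)).card - 1)
      (∏ j, ∑ l, δ j l • (X l : MvPolynomial ι ℕ)) := by
  classical
  -- adapted from `Literature.RingTheory.MvPolynomial.card_le_mixedBezout_of_isolated`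
  set 𝔓 : (Fin n → K) → Ideal (MvPolynomial (Fin n) K) := fun z => RingHom.ker
    (MvPolynomial.eval₂Hom (C : K →+* MvPolynomial ι K) (fun i => C (z i) * X (blk i))) with h𝔓
  -- `z ↦ 𝔓_z` is injective on `T`
  have hinj : Set.InjOn 𝔓 T := by
    intro z hz z' hz' h
    obtain ⟨τ, hτ⟩ := exists_eq_torusSmul_of_ker_eq blk (hT z hz) h
    exact (hTdist z hz z' hz' ⟨τ, hτ⟩).symm
  rw [← Finset.card_image_of_injOn hinj]
  refine card_le_mixedBezout blk hblk hr Q δ hQ hQ0 (T.image 𝔓) (fun 𝔓' h𝔓' => ?_) ?_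
  · obtain ⟨z, hz, rfl⟩ := Finset.mem_image.mp h𝔓'
    exact ⟨stub_minimalPrime_of_nondegenerate blk (hT z hz) Q δ hQ (hTQ z hz) (hnd z hz),
      ringKrullDim_quotient_ker_multiConeSubst blk (hT z hz)⟩
  · refine ⟨fun _ => T.card, fun t ht => ?_⟩
    rw [Finset.inf_image, Finset.card_image_of_injOn hinj]
    exact hilbert_inf_multiCone_eq_card blk T hT hTdist t fun l => ht l

end MixedBezoutNondegenerate

open MixedBezoutNondegenerate in
/-- **Registered sub-goal `stub_mixedBezoutNondegenerate` — refined Bézout count of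
non-degenerate zeros in a product of projective spaces, arbitrary finite index types.** Let `Q_j`
(`j ∈ J`, `|J| + |ι| = |τ|`, all blocks of `blk : τ → ι` non-empty) be non-zero multihomogeneous
forms of multidegrees `δ_j`, and `T` a finite set of common zeros with a non-zero coordinate in
every block and pairwise distinct torus orbits, each NON-DEGENERATE: every `w` with
`Σ_i ∂_i Q_j(z) w_i = 0` for all `j` is a torus direction `(c_{blk i} z_i)_i`. Then
`|T| ≤ [T^{(n_l - 1)_l}] Π_j (Σ_l δ_{j,l} T_l)`, whatever the rest of `V(Q)` (transport of
`MixedBezoutNondegenerate.card_le_mixedBezout_of_nondegenerate` along `Fintype.equivFin`).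
[cite: Fulton1998, Example 12.3.1] -/
theorem stub_mixedBezoutNondegenerate {K : Type} [Field K] [IsAlgClosed K] {ι : Type} [Fintype ι]
    [DecidableEq ι] [Nonempty ι] {τ J : Type} [Fintype τ] [DecidableEq τ] [Fintype J]
    (blk : τ → ι) (hblk : ∀ l, ∃ i, blk i = l)
    (hr : Fintype.card J + Fintype.card ι = Fintype.card τ)
    (Q : J → MvPolynomial τ K) (δ : J → ι → ℕ)
    (hQ : ∀ j, (Q j).IsWeightedHomogeneous (fun i => (Pi.single (blk i) 1 : ι → ℕ)) (δ j))
    (hQ0 : ∀ j, Q j ≠ 0) (T : Finset (τ → K))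
    (hT : ∀ z ∈ T, ∀ l, ∃ i, blk i = l ∧ z i ≠ 0)
    (hTdist : ∀ z ∈ T, ∀ z' ∈ T, (∃ c : ι → K, z' = fun i => c (blk i) * z i) → z' = z)
    (hTQ : ∀ z ∈ T, ∀ j, MvPolynomial.eval z (Q j) = 0)
    (hnd : ∀ z ∈ T, ∀ w : τ → K,
      (∀ j, ∑ i, MvPolynomial.eval z (MvPolynomial.pderiv i (Q j)) * w i = 0) →
        ∃ c : ι → K, w = fun i => c (blk i) * z i) :
    T.card ≤ coeff (Finsupp.equivFunOnFinite.symm fun l =>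
        ((univ : Finset τ).filter (fun i => blk i = l)).card - 1)
      (∏ j, ∑ l, δ j l • (X l : MvPolynomial ι ℕ)) := by
  classical
  -- adapted from `Literature.RingTheory.MvPolynomial.card_le_mixedBezout_of_isolated_fintype`
  set e := Fintype.equivFin τ with he
  set eJ := Fintype.equivFin J with heJ
  set blk' : Fin (Fintype.card τ) → ι := fun i => blk (e.symm i) with hblk'
  set Q' : Fin (Fintype.card J) → MvPolynomial (Fin (Fintype.card τ)) K :=
    fun j => rename e (Q (eJ.symm j)) with hQ'
  set δ' : Fin (Fintype.card J) → ι → ℕ := fun j => δ (eJ.symm j) with hδ'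
  have hcomp : ∀ z : τ → K, (fun i => z (e.symm (e i))) = z := fun z => by
    funext i; rw [Equiv.symm_apply_apply]
  have hinj : Function.Injective
      (fun z : τ → K => fun i : Fin (Fintype.card τ) => z (e.symm i)) := by
    intro z z' h
    rw [← hcomp z, ← hcomp z']
    funext i
    exact congrFun h (e i)
  set T' : Finset (Fin (Fintype.card τ) → K) := T.map ⟨_, hinj⟩ with hT'
  have hmemT' : ∀ z', z' ∈ T' ↔ ∃ z ∈ T, z' = fun i => z (e.symm i) := by
    intro z'
    simp only [hT', Finset.mem_map, Function.Embedding.coeFn_mk]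
    exact ⟨fun ⟨z, hz, h⟩ => ⟨z, hz, h.symm⟩, fun ⟨z, hz, h⟩ => ⟨z, hz, h.symm⟩⟩
  have hevalQ : ∀ (z : τ → K) j, MvPolynomial.eval (fun i => z (e.symm i)) (Q' j) =
      MvPolynomial.eval z (Q (eJ.symm j)) := by
    intro z j
    rw [hQ', eval_rename]
    exact congrArg (fun y => MvPolynomial.eval y (Q (eJ.symm j))) (hcomp z)
  have hevalD : ∀ (z : τ → K) (j : Fin (Fintype.card J)) (i : τ),
      MvPolynomial.eval (fun k => z (e.symm k)) (pderiv (e i) (Q' j)) =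
        MvPolynomial.eval z (pderiv i (Q (eJ.symm j))) := by
    intro z j i
    rw [hQ']
    dsimp only
    rw [pderiv_rename e.injective, eval_rename]
    exact congrArg (fun y => MvPolynomial.eval y (pderiv i (Q (eJ.symm j)))) (hcomp z)
  have hblk'' : ∀ l,
      1 ≤ ((univ : Finset (Fin (Fintype.card τ))).filter (fun i => blk' i = l)).card := by
    intro l
    obtain ⟨i, hi⟩ := hblk l
    exact Finset.card_pos.mpr ⟨e i, by simp [hblk', hi]⟩
  have hQ'' : ∀ j,
      (Q' j).IsWeightedHomogeneous (fun i => (Pi.single (blk' i) 1 : ι → ℕ)) (δ' j) := by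
    intro j
    refine isWeightedHomogeneous_rename_equiv e _ ?_
    have hw : (fun i => (Pi.single (blk' (e i)) 1 : ι → ℕ)) = fun i => Pi.single (blk i) 1 := by
      funext i; simp [hblk']
    rw [hw]
    exact hQ (eJ.symm j)
  have hQ0' : ∀ j, Q' j ≠ 0 := fun j h => hQ0 (eJ.symm j) (rename_injective _ e.injective
    (by rw [map_zero]; exact h))
  have hT'' : ∀ z' ∈ T', ∀ l, ∃ i, blk' i = l ∧ z' i ≠ 0 := by
    intro z' hz' l
    obtain ⟨z, hz, rfl⟩ := (hmemT' z').mp hz'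
    obtain ⟨i, hi, hzi⟩ := hT z hz l
    exact ⟨e i, by simp [hblk', hi], by simpa using hzi⟩
  have hTdist' : ∀ z' ∈ T', ∀ z'' ∈ T', (∃ c : ι → K, z'' = fun i => c (blk' i) * z' i) →
      z'' = z' := by
    intro z' hz' z'' hz'' ⟨c, hc⟩
    obtain ⟨z, hz, rfl⟩ := (hmemT' z').mp hz'
    obtain ⟨z₂, hz₂, rfl⟩ := (hmemT' z'').mp hz''
    have h2 : z₂ = fun i => c (blk i) * z i := by
      funext i
      have := congrFun hc (e i)
      simpa [hblk'] using this
    rw [hTdist z hz z₂ hz₂ ⟨c, h2⟩]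
  have hTQ' : ∀ z' ∈ T', ∀ j, MvPolynomial.eval z' (Q' j) = 0 := by
    intro z' hz' j
    obtain ⟨z, hz, rfl⟩ := (hmemT' z').mp hz'
    rw [hevalQ]; exact hTQ z hz _
  have hnd' : ∀ z' ∈ T', ∀ w' : Fin (Fintype.card τ) → K,
      (∀ j, ∑ i, MvPolynomial.eval z' (MvPolynomial.pderiv i (Q' j)) * w' i = 0) →
        ∃ c : ι → K, w' = fun i => c (blk' i) * z' i := by
    intro z' hz' w' hw'
    obtain ⟨z, hz, rfl⟩ := (hmemT' z').mp hz'
    obtain ⟨c, hc⟩ := hnd z hz (fun i => w' (e i)) fun j => by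
      have h := hw' (eJ j)
      rw [← Equiv.sum_comp e] at h
      simp only [hevalD, Equiv.symm_apply_apply] at h
      exact h
    refine ⟨c, funext fun i' => ?_⟩
    have := congrFun hc (e.symm i')
    simpa [hblk'] using this
  have key := card_le_mixedBezout_of_nondegenerate blk' hblk'' hr Q' δ' hQ'' hQ0' T' hT'' hTdist'
    hTQ' hnd'
  rw [hT', Finset.card_map] at key
  have hcardl : ∀ l, ((univ : Finset (Fin (Fintype.card τ))).filter (fun i => blk' i = l)).card =
      ((univ : Finset τ).filter (fun i => blk i = l)).card := by
    intro l
    have hset : (univ : Finset (Fin (Fintype.card τ))).filter (fun i => blk' i = l) =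
        ((univ : Finset τ).filter (fun i => blk i = l)).map e.toEmbedding := by
      ext i
      simp [Finset.mem_map_equiv, hblk']
    rw [hset, Finset.card_map]
  convert key using 2
  · ext l
    simp [hcardl]
  · exact Fintype.prod_equiv eJ _ _ fun j => by simp [hδ']

end Summit.ValiantsHypothesis.ValiantsHypothesis.Theorems.DetQPDetqpSuperquadratic
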